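import Mathlib
import Literature.NumberTheory.LFunctions.Zhang2022.Section12Top1225ExSums
import Literature.NumberTheory.LFunctions.Zhang2022.Section12Eq1212Profiles
import Literature.NumberTheory.LFunctions.Zhang2022.Section12Eq1212Integral
import Literature.NumberTheory.LFunctions.Zhang2022.Section10cMid1214Int
import HarnessLib

/-!
# Zhang (2022) §12 (12.13), exact reading: the top range of `S_j(𝐚₁₂,𝐚₂₅)` — the `t`-integrals of
# the gathered main term ARE the printed `z`-integrals `main1213intEx`, up to `O_{c′}(𝓛⁻¹²) = o(α)`

Topic `Literature/NumberTheory/LFunctions/Zhang2022` (Landau–Siegel audit tree; verdict-neutral).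
Y. Zhang, *Discrete mean estimates and the Landau–Siegel zero*, arXiv:2211.02515v1 (2022)
[Zhang2022LandauSiegel] — **an unrefereed manuscript under adjudication; theorem-only file (calculus and
bookkeeping of explicit functions), nothing here bears on its Theorems 1–2 or on Landau–Siegel zeros**
(lane ZHANG-L, WP12, node `Typed.Sec12C.Top1225Ex`, RT-02; layer "L4b" of zl-w12-p6's closer, written by
seat zl-w10-p5 as helper). §12 p. 71, tex L3614–L3622: "… `= (𝔞ῑ₃/((0.504)(0.498)log P))
∫_{0.496}^{0.498}𝔣𝔣_{j6}(0.498−z)𝓦_j(P^z)dz + (𝔞ῑ₄/((0.504)(0.5)log P))∫_{0.496}^{0.5}𝔣𝔣_{j7}(0.5−z)𝓦_j(P^z)dz + o(α)`".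

Layer L4a (`Top1225.gathered_eval_top`, zl-w12-p6) leaves the gathered main term of the top range as
`𝔞·(∫_{⌊P″₁⌋+1}^{P₃} ῑ₃𝓕_{j6}(P₃/t)𝓦ˣ_j(t)/(log P₃ log P₁) dt/t + ∫_{⌊P″₁⌋+1}^{P₂} ῑ₄𝓕_{j7}(P₂/t)𝓦ˣ_j(t)/(log P₂ log P₁) dt/t)`
(tree constants `P₁ = P^{0.504}`, `P₃ = P^{0.498}`, `P₂ = P^{1/2}T^{−10}`, `P″₁ = P^{0.496}Dt₀`). This file
proves that this equals `main1213intEx c′ χ j` within `K(c′)𝓛⁻¹²` (`top_integrals_sub_intEx`), hence within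
`εα` for all large `D` (`top_integrals_sub_intEx_eventually`; with the `(A)`-binder, verbatim the text of record
W12-R1: `integrals_top_eval`): (i) `t = P^z` (`integral_Ppow_Ppow`);
(ii) `𝓕_{j6}(P^{0.498−z}) = 𝔣𝔣_{j6}(0.498−z) + O_{c′}(𝓛⁻⁸)`, `𝓕_{j7}(P^{0.5−z}) = 𝔣𝔣_{j7}(0.5−z) + O_{c′}(𝓛⁻⁸)`
(sz-d34's `Sec10C.norm_frakf_sub_ffJ`), the exact window `𝓦ˣ_j` being KEPT; (iii) the three slivers the tree
constants create — the lower endpoint `⌊P″₁⌋+1` versus `P^{0.496}` (`log(Dt₀) + 1 ≤ 521𝓛`), the upper endpoint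
`P₂` versus `P^{1/2}` (`10 log T = 10𝓛^{1.1}`), and `𝓕_{j7}(P₂/t)` versus `𝓕_{j7}(P^{1/2}/t)`
(`Sec12C.norm_frakfW7_P2_sub_le`, `≤ 940α𝓛^{1.1}`) — each against the bounded profile
(`Top1225.profile_bounds`, `≤ 29W₀`); (iv) `1/log P₂` versus `1/(0.5 log P)` (`≤ 50𝓛^{1.1}𝓛⁻¹⁸`). With the
prefactor `𝔞|ι|/(log P_k log P₁) ≪ 𝓛⁴𝓛⁻¹⁸` the total is `≪_{c′} 𝓛^{6}𝓛⁻¹⁸ = 𝓛⁻¹²`.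

## References

* Y. Zhang, arXiv:2211.02515v1 (2022), §12 (12.13) p. 71, tex L3614–L3624; §8 (8.13)–(8.18) p. 48;
  §2 (2.6), (2.10). [cite: Zhang2022LandauSiegel, §12 (12.13) p. 71]
-/

noncomputable section

open Complex Real ComplexConjugate

namespace Literature.NumberTheory.LFunctions.Zhang2022.Typed.Sec12C

open Literature.NumberTheory.LFunctions.Zhang2022.Skeleton
open Literature.NumberTheory.LFunctions.Zhang2022.Typed.Sec10C (frakA_eq_cD_mul bigP_rpow_eq_Ppow
  one_le_bigP norm_iota34_le norm_frakf_sub_ffJ frakfW6_at_rpow frakfW7_at_rpow norm_ffJ6_le norm_ffJ7_le)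
open Literature.NumberTheory.LFunctions.Zhang2022.Typed.Sec10C.Ranges1422 (log_P2_bounds three_le_of_ell
  norm_deriv_L_one_le)

namespace Top1225

section Int

variable (c' : ℝ) {D : ℕ}

/-! ## Calculus helpers -/

omit c' in
/-- `‖∫ₐᵇ G(t)dt/t‖ ≤ M log(b/a)` for `0 < a ≤ b` and `‖G‖ ≤ M` on `[a,b]`. [folklore] -/
private theorem norm_integral_div_le_log {G : ℝ → ℂ} {a b M : ℝ} (ha : 0 < a) (hab : a ≤ b)
    (hM : ∀ t ∈ Set.Icc a b, ‖G t‖ ≤ M) :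
    ‖∫ t in a..b, G t / (t : ℂ)‖ ≤ M * Real.log (b / a) := by
  have hb : 0 < b := lt_of_lt_of_le ha hab
  have hg : IntervalIntegrable (fun t : ℝ => M * t⁻¹) MeasureTheory.volume a b := by
    refine ContinuousOn.intervalIntegrable ?_
    rw [Set.uIcc_of_le hab]
    exact ContinuousOn.mul continuousOn_const
      (continuousOn_inv₀.mono fun t ht => (lt_of_lt_of_le ha ht.1).ne')
  have h := intervalIntegral.norm_integral_le_of_norm_le (μ := MeasureTheory.volume) hab
    (f := fun t : ℝ => G t / (t : ℂ)) (g := fun t : ℝ => M * t⁻¹)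
    (Filter.Eventually.of_forall fun t ht => by
      have ht0 : 0 < t := lt_trans ha ht.1
      rw [norm_div, Complex.norm_real, Real.norm_of_nonneg ht0.le, div_eq_mul_inv]
      exact mul_le_mul_of_nonneg_right (hM t ⟨ht.1.le, ht.2⟩) (inv_nonneg.mpr ht0.le)) hg
  refine h.trans (le_of_eq ?_)
  rw [intervalIntegral.integral_const_mul, integral_inv_of_pos ha hb]

omit c' in
/-- A continuous-on-`[1,P]` profile divided by `t` is interval-integrable between points of `[1,P]`.
[folklore] -/
private theorem intervalIntegrable_div {G : ℝ → ℂ} {P a b : ℝ} (hG : ContinuousOn G (Set.Icc 1 P))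
    (ha : 1 ≤ a) (haP : a ≤ P) (hb : 1 ≤ b) (hbP : b ≤ P) :
    IntervalIntegrable (fun t : ℝ => G t / (t : ℂ)) MeasureTheory.volume a b := by
  refine ContinuousOn.intervalIntegrable ?_
  have hsub : Set.uIcc a b ⊆ Set.Icc 1 P := Set.uIcc_subset_Icc ⟨ha, haP⟩ ⟨hb, hbP⟩
  refine ContinuousOn.div (hG.mono hsub) Complex.continuous_ofReal.continuousOn fun t ht => ?_
  have : (1 : ℝ) ≤ t := (hsub ht).1
  exact_mod_cast (by linarith : t ≠ 0)

/-! ## The tree constants of the top range -/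

omit c' in
/-- For `𝓛 ≥ 5`: `lo := P^{0.496} ≤ ⌊P″₁⌋ + 1 =: lo′`, `1 ≤ lo`, `lo′ ≤ P₃ ≤ P₂ ≤ P^{1/2} ≤ P`,
`log(lo′/lo) ≤ 521𝓛`, `log(P^{1/2}/P₂) = 10𝓛^{1.1}`, `log P₃ = 0.498𝓛⁹`, `log P₁ = 0.504𝓛⁹`,
`log P₂ = 0.5𝓛⁹ − 10𝓛^{1.1} ≥ 0.4𝓛⁹`, `log P = 𝓛⁹`. [cite: Zhang2022LandauSiegel, §2 (2.6), §12 p. 69] -/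
theorem int_range_facts (hℓ5 : 5 ≤ ell D) :
    1 ≤ bigP D ^ (0.496 : ℝ) ∧ bigP D ^ (0.496 : ℝ) ≤ ((⌊P1pp D⌋₊ + 1 : ℕ) : ℝ) ∧
      ((⌊P1pp D⌋₊ + 1 : ℕ) : ℝ) ≤ Skeleton.P3 D ∧ Skeleton.P3 D ≤ Skeleton.P2 D ∧
      Skeleton.P2 D ≤ bigP D ^ (0.5 : ℝ) ∧ bigP D ^ (0.5 : ℝ) ≤ bigP D ∧
      Real.log (((⌊P1pp D⌋₊ + 1 : ℕ) : ℝ) / bigP D ^ (0.496 : ℝ)) ≤ 521 * ell D ∧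
      Real.log (bigP D ^ (0.5 : ℝ) / Skeleton.P2 D) = 10 * ell D ^ (1.1 : ℝ) ∧
      Real.log (Skeleton.P3 D) = 0.498 * ell D ^ 9 ∧ Real.log (Skeleton.P1 D) = 0.504 * ell D ^ 9 ∧
      Real.log (Skeleton.P2 D) = 0.5 * ell D ^ 9 - 10 * ell D ^ (1.1 : ℝ) ∧
      0.4 * ell D ^ 9 ≤ Real.log (Skeleton.P2 D) ∧ Real.log (bigP D) = ell D ^ 9 ∧
      Skeleton.P3 D = bigP D ^ (0.498 : ℝ) := by
  have hℓ4 : 4 ≤ ell D := by linarith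
  have hℓ3 : 3 ≤ ell D := by linarith
  have hℓ1 : 1 ≤ ell D := by linarith
  have hℓ0 : 0 < ell D := by linarith
  have hP0 : 0 < bigP D := bigP_pos D
  have hP1 : 1 ≤ bigP D := one_le_bigP D
  obtain ⟨h2TP1pp, hP1pp1, -, hP32, -, hP2P, -⟩ := top_range_sizes (D := D) hℓ5
  obtain ⟨hlogP3, -, -, -, -, -⟩ := Section9Gathering.params3 (D := D) hℓ4
  obtain ⟨hlogP2lo, -⟩ := log_P2_bounds (D := D) hℓ3
  have hlogP : Real.log (bigP D) = ell D ^ 9 := by rw [bigP, Real.log_exp]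
  have hT1 : 1 ≤ bigT D := Real.one_le_exp (Real.rpow_nonneg hℓ0.le _)
  have hT0 : 0 < bigT D := by linarith
  have hlo1 : 1 ≤ bigP D ^ (0.496 : ℝ) := Real.one_le_rpow hP1 (by norm_num)
  have hlo0 : 0 < bigP D ^ (0.496 : ℝ) := by linarith
  have hD3 : 3 ≤ D := three_le_of_ell hℓ3
  have hD1 : (1 : ℝ) ≤ D := by exact_mod_cast (by omega : 1 ≤ D)
  have ht0 : t0 D = ell D ^ 519 := rfl
  have ht01 : 1 ≤ t0 D := by rw [ht0]; exact one_le_pow₀ hℓ1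
  have hP1pp_eq : P1pp D = bigP D ^ (0.496 : ℝ) * D * t0 D := rfl
  -- `lo ≤ P″₁ < lo′ ≤ P″₁ + 1 ≤ 2P″₁ ≤ 2T P″₁ < P₃`
  have hloP1pp : bigP D ^ (0.496 : ℝ) ≤ P1pp D := by
    rw [hP1pp_eq]
    calc bigP D ^ (0.496 : ℝ) = bigP D ^ (0.496 : ℝ) * 1 * 1 := by ring
      _ ≤ bigP D ^ (0.496 : ℝ) * D * t0 D := by gcongr
  have hlo'gt : P1pp D < ((⌊P1pp D⌋₊ + 1 : ℕ) : ℝ) := by push_cast; exact Nat.lt_floor_add_one _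
  have hlo'le : ((⌊P1pp D⌋₊ + 1 : ℕ) : ℝ) ≤ P1pp D + 1 := by
    push_cast; linarith [Nat.floor_le (by linarith : (0 : ℝ) ≤ P1pp D)]
  have hlo'P3 : ((⌊P1pp D⌋₊ + 1 : ℕ) : ℝ) ≤ Skeleton.P3 D := by
    have : P1pp D + 1 ≤ 2 * bigT D * P1pp D := by nlinarith
    linarith
  -- `P₂ = P^{1/2}/T^{10} ≤ P^{1/2} ≤ P`
  have hP2_eq : Skeleton.P2 D = bigP D ^ (0.5 : ℝ) / bigT D ^ 10 := rfl
  have hT10 : 1 ≤ bigT D ^ 10 := one_le_pow₀ hT1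
  have hsq0 : 0 < bigP D ^ (0.5 : ℝ) := Real.rpow_pos_of_pos hP0 _
  have hP2sq : Skeleton.P2 D ≤ bigP D ^ (0.5 : ℝ) := by
    rw [hP2_eq]; exact div_le_self hsq0.le hT10
  have hsqP : bigP D ^ (0.5 : ℝ) ≤ bigP D := by
    calc bigP D ^ (0.5 : ℝ) ≤ bigP D ^ (1 : ℝ) := Real.rpow_le_rpow_of_exponent_le hP1 (by norm_num)
      _ = bigP D := Real.rpow_one _
  -- the logarithms
  have hlog_lo' : Real.log (((⌊P1pp D⌋₊ + 1 : ℕ) : ℝ) / bigP D ^ (0.496 : ℝ)) ≤ 521 * ell D := by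
    have hP1pp0 : 0 < P1pp D := by linarith
    have hub : ((⌊P1pp D⌋₊ + 1 : ℕ) : ℝ) / bigP D ^ (0.496 : ℝ) ≤ 2 * D * t0 D := by
      rw [div_le_iff₀ hlo0]
      calc ((⌊P1pp D⌋₊ + 1 : ℕ) : ℝ) ≤ P1pp D + 1 := hlo'le
        _ ≤ 2 * P1pp D := by linarith
        _ = 2 * D * t0 D * bigP D ^ (0.496 : ℝ) := by rw [hP1pp_eq]; ring
    have hpos : 0 < ((⌊P1pp D⌋₊ + 1 : ℕ) : ℝ) / bigP D ^ (0.496 : ℝ) := by positivity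
    have hlogD : Real.log D = ell D := rfl
    have hlogt0 : Real.log (t0 D) = 519 * Real.log (ell D) := by rw [ht0, Real.log_pow]; push_cast; ring
    have hlogℓ : Real.log (ell D) ≤ ell D / 2 := by
      have h := Real.log_le_sub_one_of_pos (show 0 < ell D / 2 by positivity)
      have h2 : Real.log (ell D) = Real.log (ell D / 2) + Real.log 2 := by
        rw [← Real.log_mul (by positivity) (by norm_num)]; ring_nf
      have hlog2 : Real.log 2 ≤ 1 := by
        have := Real.log_two_lt_d9; linarith
      linarith
    have hlog2 : Real.log 2 ≤ 1 := by have := Real.log_two_lt_d9; linarith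
    calc Real.log (((⌊P1pp D⌋₊ + 1 : ℕ) : ℝ) / bigP D ^ (0.496 : ℝ))
        ≤ Real.log (2 * D * t0 D) := Real.log_le_log hpos hub
      _ = Real.log 2 + Real.log D + Real.log (t0 D) := by
          rw [Real.log_mul (by positivity) (by positivity), Real.log_mul (by norm_num) (by positivity)]
      _ ≤ 1 + ell D + 519 * (ell D / 2) := by rw [hlogD, hlogt0]; gcongr
      _ ≤ 521 * ell D := by linarith
  have hlog_sq_P2 : Real.log (bigP D ^ (0.5 : ℝ) / Skeleton.P2 D) = 10 * ell D ^ (1.1 : ℝ) := by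
    have e : bigP D ^ (0.5 : ℝ) / Skeleton.P2 D = bigT D ^ 10 := by
      rw [hP2_eq]; field_simp
    rw [e, Real.log_pow, bigT, Real.log_exp]; push_cast; ring
  have hlogP1 : Real.log (Skeleton.P1 D) = 0.504 * ell D ^ 9 := by
    rw [Skeleton.P1, Real.log_rpow hP0, hlogP]
  have hlogP2 : Real.log (Skeleton.P2 D) = 0.5 * ell D ^ 9 - 10 * ell D ^ (1.1 : ℝ) := by
    rw [hP2_eq, Real.log_div hsq0.ne' (by positivity), Real.log_rpow hP0, hlogP, Real.log_pow, bigT,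
      Real.log_exp]; push_cast; ring
  exact ⟨hlo1, hloP1pp.trans hlo'gt.le, hlo'P3, hP32, hP2sq, hsqP, hlog_lo', hlog_sq_P2, hlogP3, hlogP1,
    hlogP2, hlogP2lo, hlogP, rfl⟩

/-! ## The profiles at `t = P^z` -/

/-- `𝓕_{j6}(P^{0.498}/P^z)𝓦ˣ_j(P^z) = 𝔣𝔣_{j6}(0.498 − z)𝓦ˣ_j(P^z) + O(5π|c′|α𝓛·‖𝓦ˣ_j(P^z)‖)` for
`|0.498 − z| ≤ 1`, `j ∈ {1,2,3}` (sz-d34's main-value comparison, exact weight kept).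
[cite: Zhang2022LandauSiegel, §8 (8.13)–(8.15) p. 48] -/
theorem f6W_at_rpow (hΛ : 0 < Real.log (bigP D)) {j : ℕ} (hj : j ∈ ({1, 2, 3} : Finset ℕ)) {z : ℝ}
    (hz : |0.498 - z| ≤ 1) (W : ℂ) :
    ‖frakfW c' D j 6 (bigP D ^ (0.498 : ℝ) / bigP D ^ z) * W - ffj j 6 (0.498 - z) * W‖ ≤
      5 * π * |c' * alpha D * ell D| * ‖W‖ := by
  rw [← sub_mul, norm_mul, frakfW6_at_rpow c' D j z, (ffj_eq_ffJ hj).1]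
  refine mul_le_mul_of_nonneg_right ?_ (norm_nonneg _)
  refine ((norm_frakf_sub_ffJ (c' := c') hΛ hj (0.498 - z)).1).trans ?_
  calc 5 * π * |c' * alpha D * ell D| * |0.498 - z| ≤ 5 * π * |c' * alpha D * ell D| * 1 := by gcongr
    _ = _ := mul_one _

/-- `𝓕_{j7}(P^{0.5}/P^z)𝓦ˣ_j(P^z) = 𝔣𝔣_{j7}(0.5 − z)𝓦ˣ_j(P^z) + O(5π|c′|α𝓛·‖𝓦ˣ_j(P^z)‖)` for `|0.5 − z| ≤ 1`,
`j ∈ {1,2,3}`. [cite: Zhang2022LandauSiegel, §8 (8.16)–(8.18) p. 48] -/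
theorem f7W_at_rpow (hΛ : 0 < Real.log (bigP D)) {j : ℕ} (hj : j ∈ ({1, 2, 3} : Finset ℕ)) {z : ℝ}
    (hz : |0.5 - z| ≤ 1) (W : ℂ) :
    ‖frakfW c' D j 7 (bigP D ^ (0.5 : ℝ) / bigP D ^ z) * W - ffj j 7 (0.5 - z) * W‖ ≤
      5 * π * |c' * alpha D * ell D| * ‖W‖ := by
  rw [← sub_mul, norm_mul, frakfW7_at_rpow c' D j z, (ffj_eq_ffJ hj).2]
  refine mul_le_mul_of_nonneg_right ?_ (norm_nonneg _)
  refine ((norm_frakf_sub_ffJ (c' := c') hΛ hj (0.5 - z)).2).trans ?_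
  calc 5 * π * |c' * alpha D * ell D| * |0.5 - z| ≤ 5 * π * |c' * alpha D * ell D| * 1 := by gcongr
    _ = _ := mul_one _

omit c' in
/-- `𝔣𝔣_{jμ}` is continuous (`j ∈ {1,2,3}`, `μ ∈ {6,7}`). [cite: Zhang2022LandauSiegel, §8 (8.13)–(8.18) p. 48] -/
theorem continuous_ffj {j : ℕ} (hj : j ∈ ({1, 2, 3} : Finset ℕ)) :
    Continuous (ffj j 6) ∧ Continuous (ffj j 7) := by
  simp only [Finset.mem_insert, Finset.mem_singleton] at hj
  rcases hj with rfl | rfl | rfl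
  · exact ⟨continuous_ff16, continuous_ff17⟩
  · exact ⟨continuous_ff26, continuous_ff27⟩
  · exact ⟨continuous_ff36, continuous_ff37⟩

/-! ## One window: `t`-integral of the profile versus the `z`-integral of its main value -/

/-- **The generic window step.** Let `G(t) = 𝓕_{jμ}(Q/t)𝓦ˣ_j(t)` with `1 ≤ Q ≤ P`, `θ ∈ [0.498, 0.5]`, and
`g` continuous with `‖𝓕_{jμ}(Q/P^z)𝓦ˣ_j(P^z) − g(θ−z)𝓦ˣ_j(P^z)‖ ≤ C_g‖𝓦ˣ_j(P^z)‖` on `z ∈ [0.496, θ]`. Then for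
endpoints `P^{0.496} ≤ a` and `b ≤ P^θ` inside `[1, P]`:
`‖∫ₐᵇ G dt/t − log P·∫_{0.496}^{θ} g(θ−z)𝓦ˣ_j(P^z)dz‖ ≤ 29W₀(log(a/P^{0.496}) + log(P^θ/b)) + log P·(θ−0.496)·C_gW₀`.
[cite: Zhang2022LandauSiegel, §12 (12.13) p. 71] -/
theorem window_integral_sub (hℓ3 : 3 ≤ ell D) (hc5 : 5 * |c'| * alpha D * ell D ≤ 1) (j μ : ℕ)
    {Q θ a b : ℝ} (hQ1 : 1 ≤ Q) (hQP : Q ≤ bigP D) (hθ0 : 0.496 ≤ θ) (hθ1 : θ ≤ 1)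
    (ha : bigP D ^ (0.496 : ℝ) ≤ a) (hab : a ≤ b) (hb : b ≤ bigP D ^ θ)
    {g : ℝ → ℂ} (hg : Continuous g) {Cg : ℝ} (hCg : 0 ≤ Cg)
    (hgz : ∀ z, 0.496 ≤ z → z ≤ θ →
      ‖frakfW c' D j μ (Q / bigP D ^ z) * frakwEx c' D j (bigP D ^ z) -
          g (θ - z) * frakwEx c' D j (bigP D ^ z)‖ ≤ Cg * ‖frakwEx c' D j (bigP D ^ z)‖) :
    ‖(∫ t in a..b, frakfW c' D j μ (Q / t) * frakwEx c' D j t / (t : ℂ)) -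
        (Real.log (bigP D) : ℂ) * ∫ z in (0.496 : ℝ)..θ, g (θ - z) * frakwEx c' D j (bigP D ^ z)‖ ≤
      29 * (1 + 3 * (3 * π * (1 + 5 * |c'| * π)) + 2 * (3 * π * (1 + 5 * |c'| * π)) ^ 2) *
          (Real.log (a / bigP D ^ (0.496 : ℝ)) + Real.log (bigP D ^ θ / b)) +
        Real.log (bigP D) * (θ - 0.496) *
          (Cg * (1 + 3 * (3 * π * (1 + 5 * |c'| * π)) + 2 * (3 * π * (1 + 5 * |c'| * π)) ^ 2)) := by
  -- parameters
  have hℓ0 : 0 < ell D := by linarith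
  have hP0 : 0 < bigP D := bigP_pos D
  have hP1 : 1 ≤ bigP D := one_le_bigP D
  have hΛ : Real.log (bigP D) = ell D ^ 9 := by rw [bigP, Real.log_exp]
  have hΛ0 : 0 ≤ Real.log (bigP D) := by rw [hΛ]; positivity
  set W₀ : ℝ := 1 + 3 * (3 * π * (1 + 5 * |c'| * π)) + 2 * (3 * π * (1 + 5 * |c'| * π)) ^ 2 with hW₀
  have hW₀0 : 0 ≤ W₀ := by rw [hW₀]; positivity
  set lo : ℝ := bigP D ^ (0.496 : ℝ) with hlodef
  set hi : ℝ := bigP D ^ θ with hhidef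
  have hlo1 : 1 ≤ lo := Real.one_le_rpow hP1 (by norm_num)
  have hlohi : lo ≤ hi := Real.rpow_le_rpow_of_exponent_le hP1 hθ0
  have hhiP : hi ≤ bigP D := by
    calc hi ≤ bigP D ^ (1 : ℝ) := Real.rpow_le_rpow_of_exponent_le hP1 hθ1
      _ = bigP D := Real.rpow_one _
  have ha1 : 1 ≤ a := hlo1.trans ha
  have hb1 : 1 ≤ b := ha1.trans hab
  have hbP : b ≤ bigP D := hb.trans hhiP
  have haP : a ≤ bigP D := hab.trans hbP
  -- the profile on `[1, P]`
  obtain ⟨G, hGdef⟩ : ∃ G : ℝ → ℂ, G = fun u : ℝ => frakfW c' D j μ (Q / u) * frakwEx c' D j u :=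
    ⟨_, rfl⟩
  have hGb : ∀ t, 1 ≤ t → t ≤ bigP D → DifferentiableAt ℝ G t ∧ ‖G t‖ ≤ 29 * W₀ := by
    intro t ht1 htP
    obtain ⟨hd, hn, -⟩ := profile_bounds c' hℓ3 hc5 j μ hQ1 hQP ht1 htP
    rw [hGdef]; exact ⟨hd, hn⟩
  have hGc : ContinuousOn G (Set.Icc 1 (bigP D)) := fun t ht =>
    (hGb t ht.1 ht.2).1.continuousAt.continuousWithinAt
  have hGI := fun (x y : ℝ) (hx : 1 ≤ x) (hxP : x ≤ bigP D) (hy : 1 ≤ y) (hyP : y ≤ bigP D) =>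
    intervalIntegrable_div (G := G) hGc hx hxP hy hyP
  -- (i) `∫ₐᵇ = ∫_{lo}^{hi} − ∫_{lo}^{a} − ∫_{b}^{hi}`
  have hsplit : ∫ t in a..b, G t / (t : ℂ) =
      (∫ t in lo..hi, G t / (t : ℂ)) - (∫ t in lo..a, G t / (t : ℂ)) - ∫ t in b..hi, G t / (t : ℂ) := by
    have h1 := intervalIntegral.integral_add_adjacent_intervals (hGI lo a hlo1 (hlohi.trans hhiP) ha1 haP)
      (hGI a b ha1 haP hb1 hbP)
    have h2 := intervalIntegral.integral_add_adjacent_intervals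
      (hGI lo b hlo1 (hlohi.trans hhiP) hb1 hbP) (hGI b hi hb1 hbP (hlo1.trans hlohi) hhiP)
    rw [← h2, ← h1]; ring
  -- (ii) the two slivers
  have hsl1 : ‖∫ t in lo..a, G t / (t : ℂ)‖ ≤ 29 * W₀ * Real.log (a / lo) :=
    norm_integral_div_le_log (by linarith) ha fun t ht => (hGb t (hlo1.trans ht.1) (ht.2.trans haP)).2
  have hsl2 : ‖∫ t in b..hi, G t / (t : ℂ)‖ ≤ 29 * W₀ * Real.log (hi / b) :=
    norm_integral_div_le_log (by linarith) hb fun t ht => (hGb t (hb1.trans ht.1) (ht.2.trans hhiP)).2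
  -- (iii) the substitution `t = P^z` on `[lo, hi]`
  obtain ⟨Λ, hΛdef⟩ : ∃ Λ : ℝ, Λ = Real.log (bigP D) := ⟨_, rfl⟩
  have hsub : ∫ t in lo..hi, G t / (t : ℂ) = (Λ : ℂ) * ∫ z in (0.496 : ℝ)..θ, G (bigP D ^ z) := by
    rw [hlodef, hhidef, bigP_rpow_eq_Ppow D 0.496, bigP_rpow_eq_Ppow D θ, ← hΛdef,
      integral_Ppow_Ppow (by rw [hΛdef]; exact hΛ0)]
    congr 1
    refine intervalIntegral.integral_congr fun z _ => ?_
    simp only [bigP_rpow_eq_Ppow D z, ← hΛdef]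
  -- (iv) the comparison at `P^z`
  obtain ⟨Iz, hIz⟩ : ∃ Iz : ℝ → ℂ, Iz = fun z => g (θ - z) * frakwEx c' D j (bigP D ^ z) := ⟨_, rfl⟩
  have hWz : ∀ z : ℝ, 0 ≤ z → z ≤ 1 → ‖frakwEx c' D j (bigP D ^ z)‖ ≤ W₀ := by
    intro z hz0 hz1
    have hz1' : 1 ≤ bigP D ^ z := Real.one_le_rpow hP1 hz0
    have hzP : bigP D ^ z ≤ bigP D := by
      calc bigP D ^ z ≤ bigP D ^ (1 : ℝ) := Real.rpow_le_rpow_of_exponent_le hP1 hz1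
        _ = bigP D := Real.rpow_one _
    rw [hW₀]; exact norm_frakwEx_le c' hℓ3 j hz1' hzP
  have hpt : ∀ z ∈ Set.uIoc (0.496 : ℝ) θ, ‖G (bigP D ^ z) - Iz z‖ ≤ Cg * W₀ := by
    intro z hz
    rw [Set.uIoc_of_le hθ0, Set.mem_Ioc] at hz
    rw [hGdef, hIz]
    refine (hgz z hz.1.le hz.2).trans ?_
    exact mul_le_mul_of_nonneg_left (hWz z (by linarith [hz.1]) (hz.2.trans hθ1)) hCg
  have hGzc : ContinuousOn (fun z : ℝ => G (bigP D ^ z)) (Set.uIcc (0.496 : ℝ) θ) := by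
    intro z hz
    rw [Set.uIcc_of_le hθ0] at hz
    have hz1 : 1 ≤ bigP D ^ z := Real.one_le_rpow hP1 (by linarith [hz.1])
    have hzP : bigP D ^ z ≤ bigP D := by
      calc bigP D ^ z ≤ bigP D ^ (1 : ℝ) := Real.rpow_le_rpow_of_exponent_le hP1 (hz.2.trans hθ1)
        _ = bigP D := Real.rpow_one _
    exact ((hGb _ hz1 hzP).1.continuousAt.comp (Real.continuousAt_const_rpow hP0.ne')).continuousWithinAt
  have hWc : ContinuousOn (fun z : ℝ => frakwEx c' D j (bigP D ^ z)) (Set.uIcc (0.496 : ℝ) θ) := by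
    intro z hz
    rw [Set.uIcc_of_le hθ0] at hz
    have hz1 : 1 ≤ bigP D ^ z := Real.one_le_rpow hP1 (by linarith [hz.1])
    have hzP : bigP D ^ z ≤ bigP D := by
      calc bigP D ^ z ≤ bigP D ^ (1 : ℝ) := Real.rpow_le_rpow_of_exponent_le hP1 (hz.2.trans hθ1)
        _ = bigP D := Real.rpow_one _
    exact ((norm_deriv_frakwEx_le c' hℓ3 j hz1 hzP).1.continuousAt.comp
      (Real.continuousAt_const_rpow hP0.ne')).continuousWithinAt
  have hIc : ContinuousOn Iz (Set.uIcc (0.496 : ℝ) θ) := by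
    rw [hIz]
    exact ((hg.comp (continuous_const.sub continuous_id)).continuousOn).mul hWc
  have hdiff : ‖(∫ z in (0.496 : ℝ)..θ, G (bigP D ^ z)) - ∫ z in (0.496 : ℝ)..θ, Iz z‖ ≤
      Cg * W₀ * (θ - 0.496) := by
    rw [← intervalIntegral.integral_sub hGzc.intervalIntegrable hIc.intervalIntegrable]
    have h := intervalIntegral.norm_integral_le_of_norm_le_const hpt
    have habs : |θ - 0.496| = θ - 0.496 := abs_of_nonneg (by linarith)
    rw [habs] at h
    exact h
  -- assemble
  have hGint : (fun t : ℝ => frakfW c' D j μ (Q / t) * frakwEx c' D j t / (t : ℂ)) =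
      fun t : ℝ => G t / (t : ℂ) := by rw [hGdef]
  rw [hGint, ← hΛdef, ← hIz, hsplit, hsub]
  have hΛ9 : Λ = Real.log (bigP D) := hΛdef
  have hΛ0' : 0 ≤ Λ := by rw [hΛ9]; exact hΛ0
  have hΛn : ‖(Λ : ℂ)‖ = Λ := by rw [Complex.norm_real, Real.norm_of_nonneg hΛ0']
  have key : (Λ : ℂ) * (∫ z in (0.496 : ℝ)..θ, G (bigP D ^ z)) - (∫ t in lo..a, G t / (t : ℂ)) -
        (∫ t in b..hi, G t / (t : ℂ)) - (Λ : ℂ) * ∫ z in (0.496 : ℝ)..θ, Iz z =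
      (Λ : ℂ) * ((∫ z in (0.496 : ℝ)..θ, G (bigP D ^ z)) - ∫ z in (0.496 : ℝ)..θ, Iz z) -
        (∫ t in lo..a, G t / (t : ℂ)) - ∫ t in b..hi, G t / (t : ℂ) := by ring
  rw [key]
  calc ‖(Λ : ℂ) * ((∫ z in (0.496 : ℝ)..θ, G (bigP D ^ z)) - ∫ z in (0.496 : ℝ)..θ, Iz z) -
          (∫ t in lo..a, G t / (t : ℂ)) - ∫ t in b..hi, G t / (t : ℂ)‖
      ≤ ‖(Λ : ℂ) * ((∫ z in (0.496 : ℝ)..θ, G (bigP D ^ z)) - ∫ z in (0.496 : ℝ)..θ, Iz z)‖ +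
          ‖∫ t in lo..a, G t / (t : ℂ)‖ + ‖∫ t in b..hi, G t / (t : ℂ)‖ := by
        refine (norm_sub_le _ _).trans ?_
        gcongr
        exact norm_sub_le _ _
    _ ≤ Λ * (Cg * W₀ * (θ - 0.496)) + 29 * W₀ * Real.log (a / lo) + 29 * W₀ * Real.log (hi / b) := by
        gcongr
        · rw [norm_mul, hΛn]; gcongr
    _ = 29 * W₀ * (Real.log (a / lo) + Real.log (hi / b)) + Λ * (θ - 0.496) * (Cg * W₀) := by ring
    _ = _ := by rw [hΛ9]

/-! ## The two windows of (12.13) -/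

/-- **Window `ϰ₃` (`μ = 6`, `Q = P₃ = P^{0.498}`, `θ = 0.498`).**
`‖∫_{⌊P″₁⌋+1}^{P₃}𝓕_{j6}(P₃/t)𝓦ˣ_j(t)dt/t − log P·∫_{0.496}^{0.498}𝔣𝔣_{j6}(0.498−z)𝓦ˣ_j(P^z)dz‖ ≤ 29W₀·521𝓛 + 0.002·log P·5π|c′α𝓛|·W₀`.
[cite: Zhang2022LandauSiegel, §12 (12.13) p. 71] -/
theorem window6_integral_sub (hℓ5 : 5 ≤ ell D) (hc5 : 5 * |c'| * alpha D * ell D ≤ 1) {j : ℕ}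
    (hj : j ∈ ({1, 2, 3} : Finset ℕ)) :
    ‖(∫ t in ((⌊P1pp D⌋₊ + 1 : ℕ) : ℝ)..Skeleton.P3 D,
          frakfW c' D j 6 (Skeleton.P3 D / t) * frakwEx c' D j t / (t : ℂ)) -
        (Real.log (bigP D) : ℂ) *
          ∫ z in (0.496 : ℝ)..0.498, ffj j 6 (0.498 - z) * frakwEx c' D j (bigP D ^ z)‖ ≤
      29 * (1 + 3 * (3 * π * (1 + 5 * |c'| * π)) + 2 * (3 * π * (1 + 5 * |c'| * π)) ^ 2) * (521 * ell D) +
        Real.log (bigP D) * (0.498 - 0.496) * (5 * π * |c' * alpha D * ell D| *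
          (1 + 3 * (3 * π * (1 + 5 * |c'| * π)) + 2 * (3 * π * (1 + 5 * |c'| * π)) ^ 2)) := by
  have hℓ3 : 3 ≤ ell D := by linarith
  obtain ⟨hlo1, hlolo', hlo'P3, -, -, -, hlog_lo', -, -, -, -, -, hlogP, hP3eq⟩ :=
    int_range_facts (D := D) hℓ5
  have hP1 : 1 ≤ bigP D := one_le_bigP D
  have hΛpos : 0 < Real.log (bigP D) := by rw [hlogP]; positivity
  have hQ1 : 1 ≤ bigP D ^ (0.498 : ℝ) := Real.one_le_rpow hP1 (by norm_num)
  have hQP : bigP D ^ (0.498 : ℝ) ≤ bigP D := by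
    calc bigP D ^ (0.498 : ℝ) ≤ bigP D ^ (1 : ℝ) := Real.rpow_le_rpow_of_exponent_le hP1 (by norm_num)
      _ = bigP D := Real.rpow_one _
  rw [hP3eq] at hlo'P3 ⊢
  have h := window_integral_sub c' hℓ3 hc5 j 6 (Q := bigP D ^ (0.498 : ℝ)) (θ := 0.498)
    (a := ((⌊P1pp D⌋₊ + 1 : ℕ) : ℝ)) (b := bigP D ^ (0.498 : ℝ)) hQ1 hQP (by norm_num) (by norm_num)
    hlolo' hlo'P3 le_rfl (continuous_ffj hj).1 (Cg := 5 * π * |c' * alpha D * ell D|) (by positivity)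
    (fun z hz0 hz1 => f6W_at_rpow c' hΛpos hj (by rw [abs_le]; constructor <;> linarith) _)
  refine h.trans ?_
  rw [div_self (by positivity : bigP D ^ (0.498 : ℝ) ≠ 0), Real.log_one, add_zero]
  have hW : 0 ≤ 29 * (1 + 3 * (3 * π * (1 + 5 * |c'| * π)) + 2 * (3 * π * (1 + 5 * |c'| * π)) ^ 2) := by
    positivity
  gcongr


/-- **Window `ϰ₂` (`μ = 7`, `Q = P₂` swapped to `P^{1/2}`, `θ = 0.5`).**
`‖∫_{⌊P″₁⌋+1}^{P₂}𝓕_{j7}(P₂/t)𝓦ˣ_j(t)dt/t − log P·∫_{0.496}^{0.5}𝔣𝔣_{j7}(0.5−z)𝓦ˣ_j(P^z)dz‖ ≤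
940α𝓛^{1.1}W₀·log P + 29W₀(521𝓛 + 10𝓛^{1.1}) + 0.004·log P·5π|c′α𝓛|·W₀`. [cite: Zhang2022LandauSiegel, §12 (12.13) p. 71] -/
theorem window7_integral_sub (hℓ5 : 5 ≤ ell D) (hc5 : 5 * |c'| * alpha D * ell D ≤ 1) {j : ℕ}
    (hj : j ∈ ({1, 2, 3} : Finset ℕ)) :
    ‖(∫ t in ((⌊P1pp D⌋₊ + 1 : ℕ) : ℝ)..Skeleton.P2 D,
          frakfW c' D j 7 (Skeleton.P2 D / t) * frakwEx c' D j t / (t : ℂ)) -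
        (Real.log (bigP D) : ℂ) *
          ∫ z in (0.496 : ℝ)..0.5, ffj j 7 (0.5 - z) * frakwEx c' D j (bigP D ^ z)‖ ≤
      940 * alpha D * ell D ^ (1.1 : ℝ) *
          (1 + 3 * (3 * π * (1 + 5 * |c'| * π)) + 2 * (3 * π * (1 + 5 * |c'| * π)) ^ 2) * Real.log (bigP D) +
        (29 * (1 + 3 * (3 * π * (1 + 5 * |c'| * π)) + 2 * (3 * π * (1 + 5 * |c'| * π)) ^ 2) *
            (521 * ell D + 10 * ell D ^ (1.1 : ℝ)) +
          Real.log (bigP D) * (0.5 - 0.496) * (5 * π * |c' * alpha D * ell D| *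
            (1 + 3 * (3 * π * (1 + 5 * |c'| * π)) + 2 * (3 * π * (1 + 5 * |c'| * π)) ^ 2))) := by
  have hℓ3 : 3 ≤ ell D := by linarith
  have hℓ0 : 0 < ell D := by linarith
  obtain ⟨hlo1, hlolo', hlo'P3, hP32, hP2sq, hsqP, hlog_lo', hlog_sq_P2, -, -, -, -, hlogP, -⟩ :=
    int_range_facts (D := D) hℓ5
  have hP1 : 1 ≤ bigP D := one_le_bigP D
  have hΛpos : 0 < Real.log (bigP D) := by rw [hlogP]; positivity
  have hα0 : 0 ≤ alpha D := by rw [alpha, hlogP]; positivity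
  set W₀ : ℝ := 1 + 3 * (3 * π * (1 + 5 * |c'| * π)) + 2 * (3 * π * (1 + 5 * |c'| * π)) ^ 2 with hW₀
  have hW₀0 : 0 ≤ W₀ := by rw [hW₀]; positivity
  set lo' : ℝ := ((⌊P1pp D⌋₊ + 1 : ℕ) : ℝ) with hlo'def
  have hlo'1 : 1 ≤ lo' := hlo1.trans hlolo'
  have hlo'P2 : lo' ≤ Skeleton.P2 D := hlo'P3.trans hP32
  have hP2one : 1 ≤ Skeleton.P2 D := hlo'1.trans hlo'P2
  have hP2P : Skeleton.P2 D ≤ bigP D := hP2sq.trans hsqP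
  have hsq1 : 1 ≤ bigP D ^ (0.5 : ℝ) := Real.one_le_rpow hP1 (by norm_num)
  -- (i) the swap `𝓕_{j7}(P₂/t) → 𝓕_{j7}(P^{1/2}/t)` under `∫_{lo′}^{P₂} dt/t`
  have hGc : ∀ Q : ℝ, 1 ≤ Q → Q ≤ bigP D →
      ContinuousOn (fun u : ℝ => frakfW c' D j 7 (Q / u) * frakwEx c' D j u) (Set.Icc 1 (bigP D)) := by
    intro Q hQ1 hQP t ht
    exact (profile_bounds c' hℓ3 hc5 j 7 hQ1 hQP ht.1 ht.2).1.continuousAt.continuousWithinAt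
  have hI₁ := intervalIntegrable_div (hGc _ hP2one hP2P) hlo'1 (hlo'P2.trans hP2P) hP2one hP2P
  have hI₂ := intervalIntegrable_div (hGc _ hsq1 hsqP) hlo'1 (hlo'P2.trans hP2P) hP2one hP2P
  have hswap : ‖(∫ t in lo'..Skeleton.P2 D, frakfW c' D j 7 (Skeleton.P2 D / t) * frakwEx c' D j t / (t : ℂ)) -
      ∫ t in lo'..Skeleton.P2 D, frakfW c' D j 7 (bigP D ^ (0.5 : ℝ) / t) * frakwEx c' D j t / (t : ℂ)‖ ≤
      940 * alpha D * ell D ^ (1.1 : ℝ) * W₀ * Real.log (bigP D) := by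
    rw [← intervalIntegral.integral_sub hI₁ hI₂]
    have hpt : ∀ t ∈ Set.Icc lo' (Skeleton.P2 D),
        ‖frakfW c' D j 7 (Skeleton.P2 D / t) * frakwEx c' D j t -
            frakfW c' D j 7 (bigP D ^ (0.5 : ℝ) / t) * frakwEx c' D j t‖ ≤
          940 * alpha D * ell D ^ (1.1 : ℝ) * W₀ := by
      intro t ht
      have ht1 : 1 ≤ t := hlo'1.trans ht.1
      have htsq : t ≤ bigP D ^ (0.5 : ℝ) := ht.2.trans hP2sq
      have htP : t ≤ bigP D := htsq.trans hsqP
      rw [← sub_mul, norm_mul]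
      have h1 := norm_frakfW7_P2_sub_le c' hℓ3 hc5 j ht1 htsq
      have h2 : ‖frakwEx c' D j t‖ ≤ W₀ := by rw [hW₀]; exact norm_frakwEx_le c' hℓ3 j ht1 htP
      calc ‖frakfW c' D j 7 (Skeleton.P2 D / t) - frakfW c' D j 7 (bigP D ^ (0.5 : ℝ) / t)‖ *
            ‖frakwEx c' D j t‖ ≤ 94 * alpha D * (10 * ell D ^ (1.1 : ℝ)) * W₀ :=
            mul_le_mul h1 h2 (norm_nonneg _) (by positivity)
        _ = 940 * alpha D * ell D ^ (1.1 : ℝ) * W₀ := by ring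
    have h := norm_integral_div_le_log (M := 940 * alpha D * ell D ^ (1.1 : ℝ) * W₀)
      (G := fun t : ℝ => frakfW c' D j 7 (Skeleton.P2 D / t) * frakwEx c' D j t -
        frakfW c' D j 7 (bigP D ^ (0.5 : ℝ) / t) * frakwEx c' D j t) (by linarith) hlo'P2 hpt
    have e : (fun t : ℝ => frakfW c' D j 7 (Skeleton.P2 D / t) * frakwEx c' D j t / (t : ℂ) -
        frakfW c' D j 7 (bigP D ^ (0.5 : ℝ) / t) * frakwEx c' D j t / (t : ℂ)) =
        fun t : ℝ => (frakfW c' D j 7 (Skeleton.P2 D / t) * frakwEx c' D j t -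
          frakfW c' D j 7 (bigP D ^ (0.5 : ℝ) / t) * frakwEx c' D j t) / (t : ℂ) := by
      funext t; ring
    rw [e]
    refine h.trans ?_
    have hlog : Real.log (Skeleton.P2 D / lo') ≤ Real.log (bigP D) := by
      refine Real.log_le_log (by positivity) ?_
      exact (div_le_self (by linarith) hlo'1).trans hP2P
    exact mul_le_mul_of_nonneg_left hlog (by positivity)
  -- (ii) the generic window step with `Q = P^{1/2}`, `b = P₂`
  have hwin := window_integral_sub c' hℓ3 hc5 j 7 (Q := bigP D ^ (0.5 : ℝ)) (θ := 0.5)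
    (a := lo') (b := Skeleton.P2 D) hsq1 hsqP (by norm_num) (by norm_num)
    hlolo' hlo'P2 hP2sq (continuous_ffj hj).2 (Cg := 5 * π * |c' * alpha D * ell D|) (by positivity)
    (fun z hz0 hz1 => f7W_at_rpow c' hΛpos hj (by rw [abs_le]; constructor <;> linarith) _)
  rw [hlog_sq_P2] at hwin
  -- assemble
  have htri := norm_sub_le_norm_sub_add_norm_sub
    (∫ t in lo'..Skeleton.P2 D, frakfW c' D j 7 (Skeleton.P2 D / t) * frakwEx c' D j t / (t : ℂ))
    (∫ t in lo'..Skeleton.P2 D, frakfW c' D j 7 (bigP D ^ (0.5 : ℝ) / t) * frakwEx c' D j t / (t : ℂ))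
    ((Real.log (bigP D) : ℂ) * ∫ z in (0.496 : ℝ)..0.5, ffj j 7 (0.5 - z) * frakwEx c' D j (bigP D ^ z))
  refine htri.trans ((add_le_add hswap hwin).trans ?_)
  have h29 : 0 ≤ 29 * W₀ := by positivity
  have hsl : 29 * W₀ * (Real.log (lo' / bigP D ^ (0.496 : ℝ)) + 10 * ell D ^ (1.1 : ℝ)) ≤
      29 * W₀ * (521 * ell D + 10 * ell D ^ (1.1 : ℝ)) := by gcongr
  linarith

/-! ## The prefactors -/

/-- `‖𝔞‖ ≤ 16e⁹𝓛⁴` (`𝔞 = c_D L′(1,χ)²`, `c_D ≤ 1`, `|L′(1,χ)| ≤ 4e^{9/2}𝓛²`).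
[cite: Zhang2022LandauSiegel, §2 (2.31), §3 Lemma 3.1 p. 13] -/
theorem norm_frakA_le [NeZero D] {χ : DirichletCharacter ℂ D} (hq : χ.IsQuadratic) (hp : χ.IsPrimitive)
    (hℓ3 : 3 ≤ ell D) : ‖(frakA χ : ℂ)‖ ≤ 16 * Real.exp 9 * ell D ^ 4 := by
  have hD3 : 3 ≤ D := three_le_of_ell hℓ3
  have hL' : ‖deriv χ.LFunction 1‖ ≤ 4 * Real.exp (9 / 2) * ell D ^ 2 := norm_deriv_L_one_le χ hℓ3 hp
  obtain ⟨hcD0, hcD1⟩ := RangeAverage.frakcD_bounds D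
  rw [frakA_eq_cD_mul χ (by omega) hq hp, norm_mul, Complex.norm_real, Real.norm_of_nonneg hcD0, norm_pow]
  have he : Real.exp (9 / 2) ^ 2 = Real.exp 9 := by rw [← Real.exp_nat_mul]; norm_num
  calc (6 / π ^ 2 * ∏ q ∈ D.primeFactors, ((q : ℝ) / (q + 1))) * ‖deriv χ.LFunction 1‖ ^ 2
      ≤ 1 * (4 * Real.exp (9 / 2) * ell D ^ 2) ^ 2 := by
        gcongr
    _ = 16 * Real.exp 9 * ell D ^ 4 := by rw [← he]; ring

/-! ## L4b: the `t`-integrals of the gathered main term are `main1213intEx` up to `O_{c′}(𝓛⁻¹²)` -/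

set_option maxHeartbeats 400000 in
-- constant bookkeeping over two windows and four prefactors
/-- **`Z22:(12.13)`, second equality, EXACT reading (layer L4b of the `Top1225Ex` closer).** For `𝓛 ≥ 5`,
`5|c′|α𝓛 ≤ 1`, `χ` real primitive and `j ∈ {1,2,3}`:
`‖𝔞·(∫_{⌊P″₁⌋+1}^{P₃} ῑ₃𝓕_{j6}(P₃/t)𝓦ˣ_j(t)/(log P₃·log P₁) dt/t + ∫_{⌊P″₁⌋+1}^{P₂} ῑ₄𝓕_{j7}(P₂/t)𝓦ˣ_j(t)/(log P₂·log P₁) dt/t)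
 − main1213intEx‖ ≤ K(c′)·𝓛⁶/𝓛¹⁸` with
`K = 16e⁹W₀·(5·(29·521 + 0.01π²|c′|) + 11.5·(940π + 29·531 + 0.02π²|c′|) + 6)`,
`W₀ = 1 + 3κ + 2κ²`, `κ = 3π(1+5|c′|π)` — i.e. `≪_{c′} 𝓛⁻¹² = o(α)`. The left integrals are exactly the
output of `Top1225.gathered_eval_top` (layer L4a). [cite: Zhang2022LandauSiegel, §12 (12.13) p. 71] -/
theorem top_integrals_sub_intEx [NeZero D] {χ : DirichletCharacter ℂ D} (hq : χ.IsQuadratic)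
    (hp : χ.IsPrimitive) (hℓ5 : 5 ≤ ell D) (hc5 : 5 * |c'| * alpha D * ell D ≤ 1) {j : ℕ}
    (hj : j ∈ ({1, 2, 3} : Finset ℕ)) :
    ‖(frakA χ : ℂ) *
          ((∫ t in ((⌊P1pp D⌋₊ + 1 : ℕ) : ℝ)..Skeleton.P3 D,
              conj iota3 / ((Real.log (Skeleton.P3 D) : ℂ) * (Real.log (Skeleton.P1 D) : ℂ)) *
                (frakfW c' D j 6 (Skeleton.P3 D / t) * frakwEx c' D j t) / t) +
            ∫ t in ((⌊P1pp D⌋₊ + 1 : ℕ) : ℝ)..Skeleton.P2 D,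
              conj iota4 / ((Real.log (Skeleton.P2 D) : ℂ) * (Real.log (Skeleton.P1 D) : ℂ)) *
                (frakfW c' D j 7 (Skeleton.P2 D / t) * frakwEx c' D j t) / t) -
        main1213intEx c' χ j‖ ≤
      16 * Real.exp 9 * (1 + 3 * (3 * π * (1 + 5 * |c'| * π)) + 2 * (3 * π * (1 + 5 * |c'| * π)) ^ 2) *
          (5 * (29 * 521 + 0.01 * π ^ 2 * |c'|) + 11.5 * (940 * π + 29 * 531 + 0.02 * π ^ 2 * |c'|) + 6) *
        ell D ^ 6 / ell D ^ 18 := by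
  have hℓ3 : 3 ≤ ell D := by linarith
  have hℓ1 : 1 ≤ ell D := by linarith
  have hℓ0 : 0 < ell D := by linarith
  obtain ⟨hlo1, hlolo', hlo'P3, hP32, hP2sq, hsqP, -, -, hlogP3, hlogP1, hlogP2, hlogP2lo, hlogP, -⟩ :=
    int_range_facts (D := D) hℓ5
  have hP1 : 1 ≤ bigP D := one_le_bigP D
  have hP0 : 0 < bigP D := bigP_pos D
  have hΛpos : 0 < Real.log (bigP D) := by rw [hlogP]; positivity
  have hαeq : alpha D = π / ell D ^ 9 := by rw [alpha, hlogP]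
  have hα0 : 0 ≤ alpha D := by rw [hαeq]; positivity
  obtain ⟨hι3, hι4⟩ := norm_iota34_le
  set W₀ : ℝ := 1 + 3 * (3 * π * (1 + 5 * |c'| * π)) + 2 * (3 * π * (1 + 5 * |c'| * π)) ^ 2 with hW₀
  have hW₀1 : 1 ≤ W₀ := by
    rw [hW₀]
    have : 0 ≤ 3 * (3 * π * (1 + 5 * |c'| * π)) + 2 * (3 * π * (1 + 5 * |c'| * π)) ^ 2 := by positivity
    linarith
  have hW₀0 : 0 ≤ W₀ := by linarith
  -- the objects
  set lo' : ℝ := ((⌊P1pp D⌋₊ + 1 : ℕ) : ℝ) with hlo'def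
  set Λ : ℝ := Real.log (bigP D) with hΛdef
  set I6 : ℂ := ∫ t in lo'..Skeleton.P3 D,
    frakfW c' D j 6 (Skeleton.P3 D / t) * frakwEx c' D j t / (t : ℂ) with hI6
  set I7 : ℂ := ∫ t in lo'..Skeleton.P2 D,
    frakfW c' D j 7 (Skeleton.P2 D / t) * frakwEx c' D j t / (t : ℂ) with hI7
  set J6 : ℂ := ∫ z in (0.496 : ℝ)..0.498, ffj j 6 (0.498 - z) * frakwEx c' D j (bigP D ^ z) with hJ6
  set J7 : ℂ := ∫ z in (0.496 : ℝ)..0.5, ffj j 7 (0.5 - z) * frakwEx c' D j (bigP D ^ z) with hJ7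
  set c6 : ℂ := conj iota3 / ((Real.log (Skeleton.P3 D) : ℂ) * (Real.log (Skeleton.P1 D) : ℂ)) with hc6
  set c7 : ℂ := conj iota4 / ((Real.log (Skeleton.P2 D) : ℂ) * (Real.log (Skeleton.P1 D) : ℂ)) with hc7
  set K6 : ℂ := (frakA χ : ℂ) * conj iota3 / (0.504 * 0.498 * Real.log (bigP D)) with hK6
  set K7 : ℂ := (frakA χ : ℂ) * conj iota4 / (0.504 * 0.5 * Real.log (bigP D)) with hK7
  -- the two window estimates
  have hE6 := window6_integral_sub c' hℓ5 hc5 hj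
  have hE7 := window7_integral_sub c' hℓ5 hc5 hj
  rw [← hW₀, ← hlo'def, ← hI6, ← hΛdef, ← hJ6] at hE6
  rw [← hW₀, ← hlo'def, ← hI7, ← hΛdef, ← hJ7] at hE7
  -- pull the constants out of the `t`-integrals
  have hpull6 : (∫ t in lo'..Skeleton.P3 D, c6 * (frakfW c' D j 6 (Skeleton.P3 D / t) * frakwEx c' D j t) /
      (t : ℂ)) = c6 * I6 := by
    rw [hI6, ← intervalIntegral.integral_const_mul]
    refine intervalIntegral.integral_congr fun t _ => ?_
    ring
  have hpull7 : (∫ t in lo'..Skeleton.P2 D, c7 * (frakfW c' D j 7 (Skeleton.P2 D / t) * frakwEx c' D j t) /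
      (t : ℂ)) = c7 * I7 := by
    rw [hI7, ← intervalIntegral.integral_const_mul]
    refine intervalIntegral.integral_congr fun t _ => ?_
    ring
  have hint : main1213intEx c' χ j = K6 * J6 + K7 * J7 := by
    simp only [main1213intEx, hK6, hK7, hJ6, hJ7]
  rw [hpull6, hpull7, hint]
  -- the algebra of the prefactors
  have hΛ0 : (Λ : ℂ) ≠ 0 := by rw [hΛdef]; exact_mod_cast hΛpos.ne'
  have hΛ9 : Λ = ell D ^ 9 := hlogP
  have hl3 : (Real.log (Skeleton.P3 D) : ℂ) = 0.498 * (Λ : ℂ) := by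
    rw [hlogP3, hΛ9]; push_cast; ring
  have hl1 : (Real.log (Skeleton.P1 D) : ℂ) = 0.504 * (Λ : ℂ) := by
    rw [hlogP1, hΛ9]; push_cast; ring
  have hl2pos : 0 < Real.log (Skeleton.P2 D) := lt_of_lt_of_le (by positivity) hlogP2lo
  have hl2 : (Real.log (Skeleton.P2 D) : ℂ) ≠ 0 := by exact_mod_cast hl2pos.ne'
  have hK6eq : (frakA χ : ℂ) * c6 * (Λ : ℂ) = K6 := by
    rw [hc6, hK6, hl3, hl1, ← hΛdef]
    field_simp
  have hK7eq : (frakA χ : ℂ) * c7 * (Λ : ℂ) - K7 =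
      (frakA χ : ℂ) * conj iota4 / 0.504 *
        ((((Λ - 2 * Real.log (Skeleton.P2 D)) / (Real.log (Skeleton.P2 D) * Λ) : ℝ)) : ℂ) := by
    rw [hc7, hK7, hl1, ← hΛdef]
    push_cast
    field_simp
    ring
  have key : (frakA χ : ℂ) * (c6 * I6 + c7 * I7) - (K6 * J6 + K7 * J7) =
      (frakA χ : ℂ) * c6 * (I6 - (Λ : ℂ) * J6) + (frakA χ : ℂ) * c7 * (I7 - (Λ : ℂ) * J7) +
        ((frakA χ : ℂ) * c6 * (Λ : ℂ) - K6) * J6 + ((frakA χ : ℂ) * c7 * (Λ : ℂ) - K7) * J7 := by ring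
  rw [key, hK6eq, sub_self, zero_mul, add_zero, hK7eq]
  -- sizes
  have hA := norm_frakA_le (D := D) hq hp hℓ3
  have hc6n : ‖c6‖ ≤ 5 / ell D ^ 18 := by
    rw [hc6, norm_div, Complex.norm_conj, norm_mul, Complex.norm_real, Complex.norm_real,
      Real.norm_of_nonneg (by rw [hlogP3]; positivity), Real.norm_of_nonneg (by rw [hlogP1]; positivity),
      hlogP3, hlogP1, div_le_div_iff₀ (by positivity) (by positivity)]
    have h18 : ell D ^ 18 = ell D ^ 9 * ell D ^ 9 := by ring
    have hX : (0 : ℝ) ≤ ell D ^ 9 * ell D ^ 9 := by positivity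
    calc ‖iota3‖ * ell D ^ 18 ≤ 1.25 * ell D ^ 18 := by gcongr
      _ = 1.25 * (ell D ^ 9 * ell D ^ 9) := by rw [h18]
      _ ≤ 5 * (0.498 * ell D ^ 9 * (0.504 * ell D ^ 9)) := by
          linarith [show 5 * (0.498 * ell D ^ 9 * (0.504 * ell D ^ 9)) = 1.25496 * (ell D ^ 9 * ell D ^ 9) by
            ring]
  have hc7n : ‖c7‖ ≤ 11.5 / ell D ^ 18 := by
    rw [hc7, norm_div, Complex.norm_conj, norm_mul, Complex.norm_real, Complex.norm_real,
      Real.norm_of_nonneg hl2pos.le, Real.norm_of_nonneg (by rw [hlogP1]; positivity), hlogP1,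
      div_le_div_iff₀ (by positivity) (by positivity)]
    have h18 : ell D ^ 18 = ell D ^ 9 * ell D ^ 9 := by ring
    have hX : (0 : ℝ) ≤ ell D ^ 9 * ell D ^ 9 := by positivity
    calc ‖iota4‖ * ell D ^ 18 ≤ 2.3 * ell D ^ 18 := by gcongr
      _ = 2.3 * (ell D ^ 9 * ell D ^ 9) := by rw [h18]
      _ ≤ 11.5 * (0.4 * ell D ^ 9 * (0.504 * ell D ^ 9)) := by
          linarith [show 11.5 * (0.4 * ell D ^ 9 * (0.504 * ell D ^ 9)) = 2.3184 * (ell D ^ 9 * ell D ^ 9) by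
            ring]
      _ ≤ 11.5 * (Real.log (Skeleton.P2 D) * (0.504 * ell D ^ 9)) := by gcongr
  have hratio : ‖((((Λ - 2 * Real.log (Skeleton.P2 D)) / (Real.log (Skeleton.P2 D) * Λ) : ℝ)) : ℂ)‖ ≤
      50 * ell D ^ (1.1 : ℝ) / ell D ^ 18 := by
    have hden : 0 < Real.log (Skeleton.P2 D) * Λ := mul_pos hl2pos (by rw [hΛ9]; positivity)
    have hnum : |Λ - 2 * Real.log (Skeleton.P2 D)| = 20 * ell D ^ (1.1 : ℝ) := by
      rw [hlogP2, hΛ9,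
        show ell D ^ 9 - 2 * (0.5 * ell D ^ 9 - 10 * ell D ^ (1.1 : ℝ)) = 20 * ell D ^ (1.1 : ℝ) by ring]
      exact abs_of_nonneg (by positivity)
    rw [Complex.norm_real, Real.norm_eq_abs, abs_div, abs_of_pos hden, hnum,
      div_le_div_iff₀ hden (by positivity)]
    have hτ0 : 0 ≤ ell D ^ (1.1 : ℝ) := by positivity
    have h18 : ell D ^ 18 = ell D ^ 9 * ell D ^ 9 := by ring
    calc 20 * ell D ^ (1.1 : ℝ) * ell D ^ 18 = 50 * ell D ^ (1.1 : ℝ) * (0.4 * ell D ^ 9 * ell D ^ 9) := by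
          rw [h18]; ring
      _ ≤ 50 * ell D ^ (1.1 : ℝ) * (Real.log (Skeleton.P2 D) * Λ) := by rw [hΛ9]; gcongr
  have hJ7n : ‖J7‖ ≤ 6 * W₀ * |0.5 - 0.496| := by
    rw [hJ7]
    refine intervalIntegral.norm_integral_le_of_norm_le_const fun z hz => ?_
    rw [Set.uIoc_of_le (by norm_num), Set.mem_Ioc] at hz
    rw [norm_mul]
    have hz1 : 1 ≤ bigP D ^ z := Real.one_le_rpow hP1 (by linarith [hz.1])
    have hzP : bigP D ^ z ≤ bigP D := by
      calc bigP D ^ z ≤ bigP D ^ (1 : ℝ) := Real.rpow_le_rpow_of_exponent_le hP1 (by linarith [hz.2])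
        _ = bigP D := Real.rpow_one _
    have hw : ‖frakwEx c' D j (bigP D ^ z)‖ ≤ W₀ := by rw [hW₀]; exact norm_frakwEx_le c' hℓ3 j hz1 hzP
    have hf : ‖ffj j 7 (0.5 - z)‖ ≤ 6 := by
      rw [(ffj_eq_ffJ hj).2]; exact norm_ffJ7_le j (by rw [abs_le]; constructor <;> linarith [hz.1, hz.2])
    exact mul_le_mul hf hw (norm_nonneg _) (by norm_num)
  -- `𝓛^{1.1} ≤ 𝓛²`, `α𝓛^{1.1}·log P = π𝓛^{1.1}`, `log P·|c′α𝓛| = π|c′|𝓛`... reduce everything to powers of `𝓛`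
  have hτ2 : ell D ^ (1.1 : ℝ) ≤ ell D ^ 2 := by
    calc ell D ^ (1.1 : ℝ) ≤ ell D ^ ((2 : ℕ) : ℝ) :=
          Real.rpow_le_rpow_of_exponent_le hℓ1 (by norm_num)
      _ = ell D ^ 2 := Real.rpow_natCast _ _
  have hτ0 : 0 ≤ ell D ^ (1.1 : ℝ) := by positivity
  have hcαℓ : |c' * alpha D * ell D| = |c'| * π / ell D ^ 8 := by
    rw [abs_mul, abs_mul, abs_of_nonneg hα0, abs_of_nonneg hℓ0.le, hαeq]
    field_simp
  have hℓ2 : ell D ≤ ell D ^ 2 := le_self_pow₀ hℓ1 two_ne_zero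
  -- E6 ≤ Ka W₀ 𝓛², E7 ≤ Kb W₀ 𝓛²
  have hE6' : ‖I6 - (Λ : ℂ) * J6‖ ≤ (29 * 521 + 0.01 * π ^ 2 * |c'|) * W₀ * ell D ^ 2 := by
    refine hE6.trans ?_
    rw [hΛ9, hcαℓ]
    have e : 29 * W₀ * (521 * ell D) + ell D ^ 9 * (0.498 - 0.496) * (5 * π * (|c'| * π / ell D ^ 8) * W₀) =
        (29 * 521 + 0.01 * π ^ 2 * |c'|) * W₀ * ell D := by
      field_simp; ring
    rw [e]
    have : 0 ≤ (29 * 521 + 0.01 * π ^ 2 * |c'|) * W₀ := by positivity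
    exact mul_le_mul_of_nonneg_left hℓ2 this
  have hE7' : ‖I7 - (Λ : ℂ) * J7‖ ≤ (940 * π + 29 * 531 + 0.02 * π ^ 2 * |c'|) * W₀ * ell D ^ 2 := by
    refine hE7.trans ?_
    rw [hΛ9, hcαℓ, hαeq]
    have e1 : 940 * (π / ell D ^ 9) * ell D ^ (1.1 : ℝ) * W₀ * ell D ^ 9 = 940 * π * W₀ * ell D ^ (1.1 : ℝ) := by
      field_simp
    have e2 : ell D ^ 9 * (0.5 - 0.496) * (5 * π * (|c'| * π / ell D ^ 8) * W₀) =
        0.02 * π ^ 2 * |c'| * W₀ * ell D := by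
      field_simp; ring
    rw [e1, e2]
    have h1 : 940 * π * W₀ * ell D ^ (1.1 : ℝ) ≤ 940 * π * W₀ * ell D ^ 2 := by gcongr
    have h2 : 29 * W₀ * (521 * ell D + 10 * ell D ^ (1.1 : ℝ)) ≤ 29 * W₀ * (521 * ell D ^ 2 + 10 * ell D ^ 2) := by
      gcongr
    have h3 : 0.02 * π ^ 2 * |c'| * W₀ * ell D ≤ 0.02 * π ^ 2 * |c'| * W₀ * ell D ^ 2 := by
      have : 0 ≤ 0.02 * π ^ 2 * |c'| * W₀ := by positivity
      exact mul_le_mul_of_nonneg_left hℓ2 this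
    linarith
  -- the three terms
  have hu0 : 0 ≤ ell D ^ 6 / ell D ^ 18 := by positivity
  have n6 : ‖(frakA χ : ℂ) * c6 * (I6 - (Λ : ℂ) * J6)‖ ≤
      16 * Real.exp 9 * ell D ^ 4 * (5 / ell D ^ 18) * ((29 * 521 + 0.01 * π ^ 2 * |c'|) * W₀ * ell D ^ 2) := by
    rw [norm_mul, norm_mul]
    exact mul_le_mul (mul_le_mul hA hc6n (norm_nonneg _) (by positivity)) hE6' (norm_nonneg _)
      (by positivity)
  have n7 : ‖(frakA χ : ℂ) * c7 * (I7 - (Λ : ℂ) * J7)‖ ≤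
      16 * Real.exp 9 * ell D ^ 4 * (11.5 / ell D ^ 18) *
        ((940 * π + 29 * 531 + 0.02 * π ^ 2 * |c'|) * W₀ * ell D ^ 2) := by
    rw [norm_mul, norm_mul]
    exact mul_le_mul (mul_le_mul hA hc7n (norm_nonneg _) (by positivity)) hE7' (norm_nonneg _)
      (by positivity)
  have nK : ‖(frakA χ : ℂ) * conj iota4 / 0.504 *
        ((((Λ - 2 * Real.log (Skeleton.P2 D)) / (Real.log (Skeleton.P2 D) * Λ) : ℝ)) : ℂ) * J7‖ ≤
      16 * Real.exp 9 * ell D ^ 4 * 2.3 / 0.504 * (50 * ell D ^ (1.1 : ℝ) / ell D ^ 18) *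
        (6 * W₀ * |0.5 - 0.496|) := by
    rw [norm_mul, norm_mul, norm_div, norm_mul, Complex.norm_conj]
    have h504 : ‖(0.504 : ℂ)‖ = 0.504 := by
      rw [show (0.504 : ℂ) = ((0.504 : ℝ) : ℂ) by norm_num, Complex.norm_real]; norm_num
    rw [h504]
    have h1 : ‖(frakA χ : ℂ)‖ * ‖iota4‖ / 0.504 ≤ 16 * Real.exp 9 * ell D ^ 4 * 2.3 / 0.504 := by
      gcongr
    exact mul_le_mul (mul_le_mul h1 hratio (norm_nonneg _) (by positivity)) hJ7n (norm_nonneg _)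
      (by positivity)
  have habs : |(0.5 : ℝ) - 0.496| = 0.004 := by norm_num
  rw [habs] at nK
  -- shares of `16e⁹W₀𝓛⁶/𝓛¹⁸`
  have hℓne : ell D ≠ 0 := hℓ0.ne'
  have s6 : 16 * Real.exp 9 * ell D ^ 4 * (5 / ell D ^ 18) * ((29 * 521 + 0.01 * π ^ 2 * |c'|) * W₀ * ell D ^ 2) =
      16 * Real.exp 9 * W₀ * (5 * (29 * 521 + 0.01 * π ^ 2 * |c'|)) * (ell D ^ 6 / ell D ^ 18) := by
    ring
  have s7 : 16 * Real.exp 9 * ell D ^ 4 * (11.5 / ell D ^ 18) *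
        ((940 * π + 29 * 531 + 0.02 * π ^ 2 * |c'|) * W₀ * ell D ^ 2) =
      16 * Real.exp 9 * W₀ * (11.5 * (940 * π + 29 * 531 + 0.02 * π ^ 2 * |c'|)) * (ell D ^ 6 / ell D ^ 18) := by
    ring
  have sK : 16 * Real.exp 9 * ell D ^ 4 * 2.3 / 0.504 * (50 * ell D ^ (1.1 : ℝ) / ell D ^ 18) * (6 * W₀ * 0.004) ≤
      16 * Real.exp 9 * W₀ * 6 * (ell D ^ 6 / ell D ^ 18) := by
    have h46 : ell D ^ 4 * ell D ^ (1.1 : ℝ) ≤ ell D ^ 6 := by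
      calc ell D ^ 4 * ell D ^ (1.1 : ℝ) ≤ ell D ^ 4 * ell D ^ 2 := by gcongr
        _ = ell D ^ 6 := by ring
    have e : 16 * Real.exp 9 * ell D ^ 4 * 2.3 / 0.504 * (50 * ell D ^ (1.1 : ℝ) / ell D ^ 18) * (6 * W₀ * 0.004) =
        16 * Real.exp 9 * W₀ * (2.3 / 0.504 * 50 * 0.024) * (ell D ^ 4 * ell D ^ (1.1 : ℝ) / ell D ^ 18) := by
      field_simp; ring
    rw [e]
    have hnum : (2.3 : ℝ) / 0.504 * 50 * 0.024 ≤ 6 := by norm_num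
    have hq' : ell D ^ 4 * ell D ^ (1.1 : ℝ) / ell D ^ 18 ≤ ell D ^ 6 / ell D ^ 18 :=
      div_le_div_of_nonneg_right h46 (by positivity)
    have hx : 0 ≤ 16 * Real.exp 9 * W₀ := by positivity
    exact mul_le_mul (mul_le_mul_of_nonneg_left hnum hx) hq' (by positivity) (by positivity)
  rw [s6] at n6
  rw [s7] at n7
  calc ‖(frakA χ : ℂ) * c6 * (I6 - (Λ : ℂ) * J6) + (frakA χ : ℂ) * c7 * (I7 - (Λ : ℂ) * J7) +
          (frakA χ : ℂ) * conj iota4 / 0.504 *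
            ((((Λ - 2 * Real.log (Skeleton.P2 D)) / (Real.log (Skeleton.P2 D) * Λ) : ℝ)) : ℂ) * J7‖
      ≤ ‖(frakA χ : ℂ) * c6 * (I6 - (Λ : ℂ) * J6)‖ + ‖(frakA χ : ℂ) * c7 * (I7 - (Λ : ℂ) * J7)‖ +
          ‖(frakA χ : ℂ) * conj iota4 / 0.504 *
            ((((Λ - 2 * Real.log (Skeleton.P2 D)) / (Real.log (Skeleton.P2 D) * Λ) : ℝ)) : ℂ) * J7‖ :=
        norm_add₃_le
    _ ≤ 16 * Real.exp 9 * W₀ * (5 * (29 * 521 + 0.01 * π ^ 2 * |c'|)) * (ell D ^ 6 / ell D ^ 18) +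
          16 * Real.exp 9 * W₀ * (11.5 * (940 * π + 29 * 531 + 0.02 * π ^ 2 * |c'|)) * (ell D ^ 6 / ell D ^ 18) +
          16 * Real.exp 9 * W₀ * 6 * (ell D ^ 6 / ell D ^ 18) := add_le_add (add_le_add n6 n7) (nK.trans sK)
    _ = _ := by ring

/-- **L4b, eventually form**: for every `ε > 0` and all large `D` (real primitive `χ`), `j = 1, 2, 3`:
the `t`-integrals of the gathered main term differ from `main1213intEx c′ χ j` by at most `εα`
(`K𝓛⁻¹² ≤ επ𝓛⁻⁹` once `𝓛³ ≥ K/(επ)`). [cite: Zhang2022LandauSiegel, §12 (12.13) p. 71] -/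
theorem top_integrals_sub_intEx_eventually :
    ∀ ε : ℝ, 0 < ε → ForAllLarge fun D _ χ => ∀ j ∈ ({1, 2, 3} : Finset ℕ),
      ‖(frakA χ : ℂ) *
            ((∫ t in ((⌊P1pp D⌋₊ + 1 : ℕ) : ℝ)..Skeleton.P3 D,
                conj iota3 / ((Real.log (Skeleton.P3 D) : ℂ) * (Real.log (Skeleton.P1 D) : ℂ)) *
                  (frakfW c' D j 6 (Skeleton.P3 D / t) * frakwEx c' D j t) / t) +
              ∫ t in ((⌊P1pp D⌋₊ + 1 : ℕ) : ℝ)..Skeleton.P2 D,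
                conj iota4 / ((Real.log (Skeleton.P2 D) : ℂ) * (Real.log (Skeleton.P1 D) : ℂ)) *
                  (frakfW c' D j 7 (Skeleton.P2 D / t) * frakwEx c' D j t) / t) -
          main1213intEx c' χ j‖ ≤ ε * alpha D := by
  intro ε hε
  set K : ℝ := 16 * Real.exp 9 * (1 + 3 * (3 * π * (1 + 5 * |c'| * π)) + 2 * (3 * π * (1 + 5 * |c'| * π)) ^ 2) *
    (5 * (29 * 521 + 0.01 * π ^ 2 * |c'|) + 11.5 * (940 * π + 29 * 531 + 0.02 * π ^ 2 * |c'|) + 6) with hK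
  have hK0 : 0 ≤ K := by rw [hK]; positivity
  have hbig : ForAllLarge fun D _ _ => K / (ε * π) + 1 ≤ ell D := by
    refine ⟨⌈Real.exp (K / (ε * π) + 1)⌉₊, fun D _ χ hD _ _ => ?_⟩
    have hexp : Real.exp (K / (ε * π) + 1) ≤ D := le_trans (Nat.le_ceil _) (by exact_mod_cast hD)
    show K / (ε * π) + 1 ≤ Real.log D
    exact (Real.le_log_iff_exp_le (lt_of_lt_of_le (Real.exp_pos _) hexp)).mpr hexp
  refine ((Sec10C.forAllLarge_five_c c').and hbig).mono ?_
  intro D _ χ hq hp ⟨⟨hD3, hℓ6, hc5⟩, hℓbig⟩ j hj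
  have hℓ5 : 5 ≤ ell D := by linarith
  have hℓ1 : 1 ≤ ell D := by linarith
  have hℓ0 : 0 < ell D := by linarith
  have h := top_integrals_sub_intEx c' hq hp hℓ5 hc5 hj
  rw [← hK] at h
  refine h.trans ?_
  have hαeq : alpha D = π / ell D ^ 9 := by rw [alpha, bigP, Real.log_exp]
  rw [hαeq]
  -- `K𝓛⁶/𝓛¹⁸ ≤ επ/𝓛⁹ ⇔ K ≤ επ𝓛³`
  have hεπ : 0 < ε * π := by positivity
  have hK3 : K ≤ ε * π * ell D ^ 3 := by
    have h1 : K / (ε * π) ≤ ell D := by linarith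
    rw [div_le_iff₀ hεπ] at h1
    have h3 : ell D ≤ ell D ^ 3 := le_self_pow₀ hℓ1 three_ne_zero
    calc K ≤ ell D * (ε * π) := h1
      _ ≤ ell D ^ 3 * (ε * π) := by gcongr
      _ = ε * π * ell D ^ 3 := by ring
  rw [div_le_iff₀ (by positivity)]
  calc K * ell D ^ 6 ≤ ε * π * ell D ^ 3 * ell D ^ 6 := by gcongr
    _ = ε * (π / ell D ^ 9) * ell D ^ 18 := by field_simp


/-- **L4b of record (`integrals_top_eval`, the text fixed on HOME/INBOX 2026-08-27T01:23:47Z / W12-R1):** for every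
`ε > 0`, all large `D` (real primitive `χ`, under `(A)` — unused), `j = 1, 2, 3`: the `t`-integrals left by
`Top1225.gathered_eval_top` equal `main1213intEx c′ χ j` within `εα`. [cite: Zhang2022LandauSiegel, §12 (12.13) p. 71] -/
theorem integrals_top_eval :
    ∀ ε > 0, ForAllLarge fun D _ χ => AssumptionA D χ → ∀ j ∈ ({1, 2, 3} : Finset ℕ),
      ‖(frakA χ : ℂ) *
            ((∫ t in ((⌊P1pp D⌋₊ + 1 : ℕ) : ℝ)..Skeleton.P3 D,
                conj iota3 / ((Real.log (Skeleton.P3 D) : ℂ) * (Real.log (Skeleton.P1 D) : ℂ)) *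
                  (frakfW c' D j 6 (Skeleton.P3 D / t) * frakwEx c' D j t) / t) +
              ∫ t in ((⌊P1pp D⌋₊ + 1 : ℕ) : ℝ)..Skeleton.P2 D,
                conj iota4 / ((Real.log (Skeleton.P2 D) : ℂ) * (Real.log (Skeleton.P1 D) : ℂ)) *
                  (frakfW c' D j 7 (Skeleton.P2 D / t) * frakwEx c' D j t) / t) -
          main1213intEx c' χ j‖ ≤ ε * alpha D :=
  fun ε hε => (top_integrals_sub_intEx_eventually c' ε hε).mono fun _ _ _ _ _ h _ => h

end Int

end Top1225

end Literature.NumberTheory.LFunctions.Zhang2022.Typed.Sec12C
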